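import Summits.KontsevichZagierPeriods.KontsevichZagierPeriods.Theorems.SoloBlindMixedDuplPrep
import HarnessLib

/-!
# Mixed duplication `B(a, a+½) = 2^{1-2a} B(2a, ½)`, II: the moves

With the identities of `SoloBlindMixedDuplPrep`, the mixed shadow of Legendre's duplication is a
chain of one-dimensional Kontsevich–Zagier moves between `ℚ`-semialgebraic representations:

1. additivity of the domain: `β(a, a+½) ≡ [(0,½), t^{a-1}(1-t)^{a-½}] + [(½,1), same]`;
2. change of variables `w = φ(t) = 2√(t(1-t))` on each half (a semialgebraic `C¹` bijection onto
   `(0,1)`; the inverse branches `t = (1 ∓ √(1-w²))/2` carry the nested radicals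
   `√((1 ± √(1-w²))/2)` into the new integrands `gL, gR`);
3. additivity of the integrand on `(0,1)`: `gL + gR = 2·4^{-a}·w^{2a-1}(1-w)^{-½}`
   (`√((1+c)/2) + √((1-c)/2) = √(1+w)`), i.e. `[(0,1), gL] + [(0,1), gR] ≡ 2·4^{-a} · β(2a, ½)`.

Main result: `betaQ_mixed_dupl : betaQ a (a + 1/2) = duplCoeff a • betaQ (2*a) (1/2)` in `Q`
for every rational `a > 0` (`duplCoeff a = 2·4^{-a} ∈ K₀`). Instances: `a = 1/8, 3/8, 1/10, 3/10`
— the relations that make levels `8` and `10` Deligne–Koblitz–Ogus-complete inside the rules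
(sequel), e.g. `β(1/8,5/8) = 2^{3/4} β(1/4,1/2)`.
-/

noncomputable section

open Set MeasureTheory MvPolynomial

namespace Summit.KontsevichZagierPeriods.KontsevichZagierPeriods.Theorems

namespace SoloBlind

open Literature.ModelTheory.ExponentialFields (IsSemialgebraic)
open Literature.NumberTheory.Transcendental
open Literature.NumberTheory.Transcendental.KZ
open Literature.Analysis.SpecialFunctions.Selberg

/-! ## Algebraic constants and semialgebraicity -/

/-- `2·4^{-a}` is algebraic (it is `duplCoeff a`). -/
theorem mixCoeff_isAlgebraic (a : ℚ) : IsAlgebraic ℚ (2 * (4:ℝ) ^ (((-a : ℚ)) : ℝ)) := by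
  have h := mem_K₀_iff.mp (duplCoeff a).2
  rw [coe_duplCoeff] at h
  push_cast
  exact h

/-- `0 < 2a` for `0 < a`. -/
theorem mix_two_mul_pos {a : ℚ} (ha : 0 < a) : (0:ℚ) < 2 * a := by positivity

/-- The line `(0,1) ⊆ ℝ¹` is `ℚ`-semialgebraic. -/
theorem mix_line_sa : IsSemialgebraic ℚ (line (Ioo (0:ℝ) 1)) :=
  isSemialgebraic_line_Ioo isAlgebraic_zero isAlgebraic_one

/-- The line `(0,½) ⊆ ℝ¹` is `ℚ`-semialgebraic. -/
theorem mix_line_left_sa : IsSemialgebraic ℚ (line (Ioo (0:ℝ) (1 / 2))) :=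
  isSemialgebraic_line_Ioo isAlgebraic_zero
    (by simpa using isAlgebraic_algebraMap (R := ℚ) (A := ℝ) (1 / 2))

/-- The line `(½,1) ⊆ ℝ¹` is `ℚ`-semialgebraic. -/
theorem mix_line_right_sa : IsSemialgebraic ℚ (line (Ioo ((1:ℝ) / 2) 1)) :=
  isSemialgebraic_line_Ioo (by simpa using isAlgebraic_algebraMap (R := ℚ) (A := ℝ) (1 / 2))
    isAlgebraic_one

/-- The constant `2` is `ℚ`-semialgebraic on a semialgebraic line set. -/
theorem isSemialgebraicFunOn_two_line {S : Set ℝ} (hS : IsSemialgebraic ℚ (line S)) :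
    IsSemialgebraicFunOn ℚ (line S) (fun _ : Fin 1 → ℝ => (2:ℝ)) :=
  isSemialgebraicFunOn_const_of_isAlgebraic hS
    (by simpa using isAlgebraic_algebraMap (R := ℚ) (A := ℝ) 2)

/-- The constant `½` is `ℚ`-semialgebraic on a semialgebraic line set. -/
theorem isSemialgebraicFunOn_half_line {S : Set ℝ} (hS : IsSemialgebraic ℚ (line S)) :
    IsSemialgebraicFunOn ℚ (line S) (fun _ : Fin 1 → ℝ => (1:ℝ) / 2) :=
  isSemialgebraicFunOn_const_of_isAlgebraic hS
    (by simpa using isAlgebraic_algebraMap (R := ℚ) (A := ℝ) (1 / 2))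

/-- `t^{a-1}(1-t)^{(a+½)-1}` is `ℚ`-semialgebraic on subintervals `(p,q) ⊆ (0,1)` with algebraic
ends. -/
theorem isSemialgebraicFunOn_mixFun (a : ℚ) {p q : ℝ} (hS : IsSemialgebraic ℚ (line (Ioo p q)))
    (h0 : 0 ≤ p) (h1 : q ≤ 1) :
    IsSemialgebraicFunOn ℚ (line (Ioo p q)) (fun x : Fin 1 → ℝ => mixFun a (x 0)) := by
  refine ((isSemialgebraicFunOn_const_mul_rpow_mul_rpow 1 (a - 1) (a + 1 / 2 - 1)).congr
    fun x _ => ?_).mono (fun x hx => ?_) hS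
  · simp only [mixFun]
    push_cast
    ring
  · have hx : x 0 ∈ Ioo p q := hx
    exact ⟨h0.trans_lt hx.1, hx.2.trans_le h1⟩

/-- `x ↦ φ(x₀) = 2√(x₀(1-x₀))` is `ℚ`-semialgebraic on any line interval with algebraic ends. -/
theorem isSemialgebraicFunOn_mixPhi {p q : ℝ} (hS : IsSemialgebraic ℚ (line (Ioo p q))) :
    IsSemialgebraicFunOn ℚ (line (Ioo p q)) (fun x : Fin 1 → ℝ => mixPhi (x 0)) := by
  have h1 : IsSemialgebraicFunOn ℚ (line (Ioo p q))
      (fun x : Fin 1 → ℝ => Real.sqrt (x 0 * (1 - x 0))) :=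
    (IsSemialgebraicFunOn.sqrt_holds
      (isSemialgebraicFunOn_aeval hS (X 0 * (1 - X 0) : MvPolynomial (Fin 1) ℚ))).congr
      fun x _ => by simp
  exact (IsSemialgebraicFunOn.mul_holds (isSemialgebraicFunOn_two_line hS) h1).congr
    fun x _ => by simp [mixPhi]

/-- `x ↦ √(1 - x₀²)` is `ℚ`-semialgebraic on the line `(0,1)`. -/
theorem isSemialgebraicFunOn_sqrt_one_sub_sq :
    IsSemialgebraicFunOn ℚ (line (Ioo (0:ℝ) 1)) (fun x : Fin 1 → ℝ => Real.sqrt (1 - x 0 ^ 2)) :=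
  (IsSemialgebraicFunOn.sqrt_holds
    (isSemialgebraicFunOn_aeval mix_line_sa (1 - X 0 ^ 2 : MvPolynomial (Fin 1) ℚ))).congr
    fun x _ => by simp

/-- `mixCore` is `ℚ`-semialgebraic on the line `(0,1)`. -/
theorem isSemialgebraicFunOn_mixCore (a : ℚ) :
    IsSemialgebraicFunOn ℚ (line (Ioo (0:ℝ) 1)) (fun x : Fin 1 → ℝ => mixCore a (x 0)) := by
  have hT := mix_line_sa
  have h1 : IsSemialgebraicFunOn ℚ (line (Ioo (0:ℝ) 1))
      (fun x : Fin 1 → ℝ => (x 0 ^ 2 / 4) ^ ((a : ℝ) - 1)) := by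
    refine (isSemialgebraicFunOn_mellinIntegrand hT ![C (1 / 4) * X 0 ^ 2] ![a - 1] 1
      (fun x hx k => ?_)).congr fun x _ => ?_
    · have hx : x 0 ∈ Ioo (0:ℝ) 1 := hx
      have hx2 : (0:ℝ) < x 0 ^ 2 := by nlinarith [hx.1]
      fin_cases k
      simp only [Fin.zero_eta, Fin.isValue, Matrix.cons_val_zero, map_mul, MvPolynomial.aeval_C,
        map_pow, MvPolynomial.aeval_X, eq_ratCast]
      push_cast
      positivity
    · simp only [mellinIntegrand, Fin.prod_univ_one, Matrix.cons_val_zero, map_mul,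
        MvPolynomial.aeval_C, map_pow, MvPolynomial.aeval_X, eq_ratCast]
      push_cast
      ring_nf
  have h2 : IsSemialgebraicFunOn ℚ (line (Ioo (0:ℝ) 1))
      (fun x : Fin 1 → ℝ => 2 * Real.sqrt (1 - x 0 ^ 2)) :=
    IsSemialgebraicFunOn.mul_holds (isSemialgebraicFunOn_two_line hT)
      isSemialgebraicFunOn_sqrt_one_sub_sq
  have h3 : IsSemialgebraicFunOn ℚ (line (Ioo (0:ℝ) 1))
      (fun x : Fin 1 → ℝ => x 0 / (2 * Real.sqrt (1 - x 0 ^ 2))) :=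
    IsSemialgebraicFunOn.div ((isSemialgebraicFunOn_aeval hT (X 0 : MvPolynomial (Fin 1) ℚ)).congr
      fun x _ => by simp) h2 fun x hx => by
        have hx : x 0 ∈ Ioo (0:ℝ) 1 := hx
        exact mul_ne_zero two_ne_zero (Real.sqrt_pos.mpr (by nlinarith [hx.1, hx.2])).ne'
  exact IsSemialgebraicFunOn.mul_holds h1 h3

/-- `gL` is `ℚ`-semialgebraic on the line `(0,1)`. -/
theorem isSemialgebraicFunOn_mixGL (a : ℚ) :
    IsSemialgebraicFunOn ℚ (line (Ioo (0:ℝ) 1)) (fun x : Fin 1 → ℝ => mixGL a (x 0)) := by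
  have hT := mix_line_sa
  have h3 : IsSemialgebraicFunOn ℚ (line (Ioo (0:ℝ) 1))
      (fun x : Fin 1 → ℝ => (1 + Real.sqrt (1 - x 0 ^ 2)) / 2) :=
    (IsSemialgebraicFunOn.mul_holds (isSemialgebraicFunOn_half_line hT)
      (IsSemialgebraicFunOn.add_holds
        (isSemialgebraicFunOn_const_of_isAlgebraic hT isAlgebraic_one)
        isSemialgebraicFunOn_sqrt_one_sub_sq)).congr fun x _ => by
      simp only [Pi.mul_apply, Pi.add_apply]
      ring
  exact IsSemialgebraicFunOn.mul_holds (isSemialgebraicFunOn_mixCore a)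
    (IsSemialgebraicFunOn.sqrt_holds h3)

/-- `gR` is `ℚ`-semialgebraic on the line `(0,1)`. -/
theorem isSemialgebraicFunOn_mixGR (a : ℚ) :
    IsSemialgebraicFunOn ℚ (line (Ioo (0:ℝ) 1)) (fun x : Fin 1 → ℝ => mixGR a (x 0)) := by
  have hT := mix_line_sa
  have h3 : IsSemialgebraicFunOn ℚ (line (Ioo (0:ℝ) 1))
      (fun x : Fin 1 → ℝ => (1 - Real.sqrt (1 - x 0 ^ 2)) / 2) :=
    (IsSemialgebraicFunOn.mul_holds (isSemialgebraicFunOn_half_line hT)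
      (IsSemialgebraicFunOn.sub_holds
        (isSemialgebraicFunOn_const_of_isAlgebraic hT isAlgebraic_one)
        isSemialgebraicFunOn_sqrt_one_sub_sq)).congr fun x _ => by
      simp only [Pi.mul_apply, Pi.sub_apply]
      ring
  exact IsSemialgebraicFunOn.mul_holds (isSemialgebraicFunOn_mixCore a)
    (IsSemialgebraicFunOn.sqrt_holds h3)

/-- `G = 2·4^{-a} w^{2a-1}(1-w)^{-½}` is `ℚ`-semialgebraic on the line `(0,1)`. -/
theorem isSemialgebraicFunOn_mixG (a : ℚ) (ha : 0 < a) :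
    IsSemialgebraicFunOn ℚ (line (Ioo (0:ℝ) 1)) (fun x : Fin 1 → ℝ => mixG a (x 0)) :=
  IsSemialgebraicFunOn.mul_holds (isSemialgebraicFunOn_const_of_isAlgebraic mix_line_sa
    (mixCoeff_isAlgebraic a))
    (betaRep (2 * a) (1 / 2) (mix_two_mul_pos ha) one_half_pos).isSemialgebraicFunOn_integrand

/-! ## The representations -/

/-- The left half `[(0,½), t^{a-1}(1-t)^{a-½}]`. -/
def mixLeft (a : ℚ) (ha : 0 < a) : IntegralRep 1 :=
  lineRep (Ioo 0 (1 / 2)) (mixFun a) mix_line_left_sa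
    (isSemialgebraicFunOn_mixFun a mix_line_left_sa le_rfl (by norm_num))
    (integrableOn_mixFun a ha le_rfl (by norm_num))

/-- The right half `[(½,1), t^{a-1}(1-t)^{a-½}]`. -/
def mixRight (a : ℚ) (ha : 0 < a) : IntegralRep 1 :=
  lineRep (Ioo (1 / 2) 1) (mixFun a) mix_line_right_sa
    (isSemialgebraicFunOn_mixFun a mix_line_right_sa (by norm_num) le_rfl)
    (integrableOn_mixFun a ha (by norm_num) le_rfl)

/-- The pushed-forward left half `[(0,1), gL]`. -/
def mixImL (a : ℚ) (ha : 0 < a) : IntegralRep 1 :=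
  lineRep (Ioo 0 1) (mixGL a) mix_line_sa (isSemialgebraicFunOn_mixGL a) (integrableOn_mixGL a ha)

/-- The pushed-forward right half `[(0,1), gR]`. -/
def mixImR (a : ℚ) (ha : 0 < a) : IntegralRep 1 :=
  lineRep (Ioo 0 1) (mixGR a) mix_line_sa (isSemialgebraicFunOn_mixGR a) (integrableOn_mixGR a ha)

/-- The sum `[(0,1), G]`. -/
def mixSum (a : ℚ) (ha : 0 < a) : IntegralRep 1 :=
  lineRep (Ioo 0 1) (mixG a) mix_line_sa (isSemialgebraicFunOn_mixG a ha) (integrableOn_mixG a ha)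

/-- The target `2·4^{-a} · β(2a,½)` as a representation. -/
def mixTarget (a : ℚ) (ha : 0 < a) : IntegralRep 1 :=
  (betaRep (2 * a) (1 / 2) (mix_two_mul_pos ha) one_half_pos).constMul
    (2 * (4:ℝ) ^ (((-a : ℚ)) : ℝ)) (mixCoeff_isAlgebraic a)

/-- `mixTarget` is literally `[(0,1), G]`. -/
theorem mixTarget_eq (a : ℚ) (ha : 0 < a) : mixTarget a ha = mixSum a ha :=
  IntegralRep.ext' rfl rfl

/-! ## The moves -/

/-- **Move 1 (domain additivity): `β(a,a+½) ≡ mixLeft + mixRight`** (the point `½` is null). -/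
theorem betaRep_sub_mixHalves (a : ℚ) (ha : 0 < a) (hb : 0 < a + 1 / 2) :
    of (betaRep a (a + 1 / 2) ha hb) - (of (mixLeft a ha) + of (mixRight a ha)) ∈ relations := by
  suffices h : of (betaRep a (a + 1 / 2) ha hb) - ∑ i ∈ (Finset.univ : Finset (Fin 2)),
      of (![mixLeft a ha, mixRight a ha] i) ∈ relations by
    rw [Fin.sum_univ_two, Matrix.cons_val_zero, Matrix.cons_val_one,
      Matrix.cons_val_fin_one] at h
    exact h
  refine of_sub_sum_of_mem_relations (Finset.univ : Finset (Fin 2)) (betaRep a (a + 1 / 2) ha hb)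
    ![mixLeft a ha, mixRight a ha] ?_ ?_ ?_ ?_
  · intro i _
    fin_cases i
    · refine measure_mono_null (fun x hx => ?_) measure_empty
      have h1 : x 0 ∈ Ioo (0:ℝ) (1 / 2) := hx.1
      exact hx.2 (show x 0 ∈ Ioo (0:ℝ) 1 from ⟨h1.1, h1.2.trans (by norm_num)⟩)
    · refine measure_mono_null (fun x hx => ?_) measure_empty
      have h1 : x 0 ∈ Ioo ((1:ℝ) / 2) 1 := hx.1
      exact hx.2 (show x 0 ∈ Ioo (0:ℝ) 1 from ⟨(by norm_num : (0:ℝ) < 1 / 2).trans h1.1, h1.2⟩)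
  · intro i _
    fin_cases i <;> exact fun _ _ => rfl
  · have hnull : volume {x : Fin 1 → ℝ | x 0 = 1 / 2} = 0 := by
      rw [volume_pi]
      exact Measure.pi_hyperplane (fun _ : Fin 1 => (volume : Measure ℝ)) 0 (1 / 2)
    refine measure_mono_null (fun x hx => ?_) hnull
    have h0 : x 0 ∈ Ioo (0:ℝ) 1 := hx.1
    have hn := hx.2
    simp only [Finset.mem_univ, iUnion_true, mem_iUnion, not_exists] at hn
    by_contra hc
    rcases lt_or_gt_of_ne hc with hlt | hgt
    · exact hn 0 (show x 0 ∈ Ioo (0:ℝ) (1 / 2) from ⟨h0.1, hlt⟩)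
    · exact hn 1 (show x 0 ∈ Ioo ((1:ℝ) / 2) 1 from ⟨hgt, h0.2⟩)
  · intro i _ j _ hij
    refine measure_mono_null (fun x hx => ?_) measure_empty
    fin_cases i <;> fin_cases j
    · exact (hij rfl).elim
    · have h1 : x 0 ∈ Ioo (0:ℝ) (1 / 2) := hx.1
      have h2 : x 0 ∈ Ioo ((1:ℝ) / 2) 1 := hx.2
      exact (lt_irrefl _ (h1.2.trans h2.1)).elim
    · have h1 : x 0 ∈ Ioo ((1:ℝ) / 2) 1 := hx.1
      have h2 : x 0 ∈ Ioo (0:ℝ) (1 / 2) := hx.2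
      exact (lt_irrefl _ (h2.2.trans h1.1)).elim
    · exact (hij rfl).elim

/-- **Move 2L (substitution `w = 2√(t(1-t))` on `(0,½)`): `mixLeft ≡ [(0,1), gL]`.** -/
theorem mixLeft_sub_mixImL (a : ℚ) (ha : 0 < a) :
    of (mixLeft a ha) - of (mixImL a ha) ∈ relations := by
  unfold mixLeft mixImL
  exact lineRep_subst mixPhi mixPhi' (isSemialgebraicFunOn_mixPhi mix_line_left_sa)
    (fun t ht => (hasDerivAt_mixPhi ht.1 (ht.2.trans one_half_lt_one)).hasDerivWithinAt)
    injOn_mixPhi_left image_mixPhi_left (fun t ht => mix_pullback_left a ht)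

/-- **Move 2R (substitution `w = 2√(t(1-t))` on `(½,1)`): `mixRight ≡ [(0,1), gR]`.** -/
theorem mixRight_sub_mixImR (a : ℚ) (ha : 0 < a) :
    of (mixRight a ha) - of (mixImR a ha) ∈ relations := by
  unfold mixRight mixImR
  exact lineRep_subst mixPhi mixPhi' (isSemialgebraicFunOn_mixPhi mix_line_right_sa)
    (fun t ht => (hasDerivAt_mixPhi (one_half_pos.trans ht.1) ht.2).hasDerivWithinAt)
    injOn_mixPhi_right image_mixPhi_right (fun t ht => mix_pullback_right a ht)

/-- **Move 3 (integrand additivity on `(0,1)`): `[(0,1), G] ≡ [(0,1), gL] + [(0,1), gR]`.** -/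
theorem mixSum_sub_sub (a : ℚ) (ha : 0 < a) :
    of (mixSum a ha) - of (mixImL a ha) - of (mixImR a ha) ∈ relations :=
  of_sub_sub_mem_relations_of_add rfl rfl fun x hx => by
    have hx : x 0 ∈ Ioo (0:ℝ) 1 := hx
    simp only [mixSum, mixImL, mixImR, lineRep_integrand]
    exact (mixGL_add_mixGR a hx.1 hx.2).symm

/-! ## Mixed duplication in `Q` -/

/-- **Mixed duplication inside the rules: `β(a, a+½) = (2·4^{-a}) • β(2a, ½)` for rational
`a > 0`.** -/
theorem betaQ_mixed_dupl (a : ℚ) (ha : 0 < a) :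
    betaQ a (a + 1 / 2) = duplCoeff a • betaQ (2 * a) (1 / 2) := by
  have hb : (0:ℚ) < a + 1 / 2 := by positivity
  have h1 : mkQ (of (betaRep a (a + 1 / 2) ha hb)) =
      mkQ (of (mixLeft a ha)) + mkQ (of (mixRight a ha)) := by
    rw [← map_add, mkQ_eq_mkQ_iff]
    exact betaRep_sub_mixHalves a ha hb
  have hL : mkQ (of (mixLeft a ha)) = mkQ (of (mixImL a ha)) :=
    mkQ_eq_mkQ_iff.mpr (mixLeft_sub_mixImL a ha)
  have hR : mkQ (of (mixRight a ha)) = mkQ (of (mixImR a ha)) :=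
    mkQ_eq_mkQ_iff.mpr (mixRight_sub_mixImR a ha)
  have hS : mkQ (of (mixSum a ha)) = mkQ (of (mixImL a ha)) + mkQ (of (mixImR a ha)) := by
    rw [← map_add, mkQ_eq_mkQ_iff]
    have h := mixSum_sub_sub a ha
    rwa [sub_sub] at h
  have hT : mkQ (of (mixTarget a ha)) = duplCoeff a • betaQ (2 * a) (1 / 2) := by
    rw [betaQ_eq (mix_two_mul_pos ha) one_half_pos, mixTarget, mkQ_constMul]
    congr 1
  rw [betaQ_eq ha hb, h1, hL, hR, ← hS, ← mixTarget_eq, hT]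

/-- Period check: `B(a, a+½) = 2·4^{-a}·B(2a, ½)` for rational `a > 0`, read off in `ℝ`. -/
theorem beta_mixed_dupl_value (a : ℚ) (ha : 0 < a) :
    evalQ (betaQ a (a + 1 / 2)) = 2 * (4:ℝ) ^ (-(a : ℝ)) * evalQ (betaQ (2 * a) (1 / 2)) := by
  rw [betaQ_mixed_dupl a ha, evalQ_smul, coe_duplCoeff]

/-- Level `8`: `β(1/8, 5/8) = 2^{3/4} • β(1/4, 1/2)` — merges the orbit `{1,2,5}` with `{2,2,4}`. -/
theorem betaQ_mixed_dupl_eighth :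
    betaQ (1 / 8) (5 / 8) = duplCoeff (1 / 8) • betaQ (1 / 4) (1 / 2) := by
  have h := betaQ_mixed_dupl (1 / 8) (by norm_num)
  norm_num at h
  exact h

/-- Level `8`: `β(3/8, 7/8) = 2^{1/4} • β(3/4, 1/2)` — merges the orbit `{3,6,7}` with `{4,6,6}`. -/
theorem betaQ_mixed_dupl_three_eighths :
    betaQ (3 / 8) (7 / 8) = duplCoeff (3 / 8) • betaQ (3 / 4) (1 / 2) := by
  have h := betaQ_mixed_dupl (3 / 8) (by norm_num)
  norm_num at h
  exact h

/-- Level `10`: `β(1/10, 3/5) = 2^{4/5} • β(1/5, 1/2)` — merges `{1,2,7}` with the class of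
`{1,4,5}`. -/
theorem betaQ_mixed_dupl_tenth :
    betaQ (1 / 10) (3 / 5) = duplCoeff (1 / 10) • betaQ (1 / 5) (1 / 2) := by
  have h := betaQ_mixed_dupl (1 / 10) (by norm_num)
  norm_num at h
  exact h

/-- Level `10`: `β(3/10, 4/5) = 2^{2/5} • β(3/5, 1/2)` — merges `{3,8,9}` with the class of
`{5,6,9}`. -/
theorem betaQ_mixed_dupl_three_tenths :
    betaQ (3 / 10) (4 / 5) = duplCoeff (3 / 10) • betaQ (3 / 5) (1 / 2) := by
  have h := betaQ_mixed_dupl (3 / 10) (by norm_num)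
  norm_num at h
  exact h

end SoloBlind

end Summit.KontsevichZagierPeriods.KontsevichZagierPeriods.Theorems
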